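import Summits.NavierStokesRegularity.FunctionalMining.NoGo.SeparableCalculus
import Literature.Analysis.FunctionSpaces.TorusVerticalLift
import Literature.Analysis.FunctionSpaces.TorusCalculus
import HarnessLib

/-!
# K1-Q2 kill-all witness, part 1/4: derivative transfer for the vertical lift; Fubini on the unit cube

Search for candidate a priori estimates; no regularity claim. NS FUNCTIONAL MINING — NO-GO BRANCH
(cell `pub-nsfunc`, no-go seat gen 7).
Folklore calculus used by the explicit kill-all witness (`NoGo/MiddleEigenvalueKillAllWitness.lean`):
* `KillAll.fderiv_comp_repr` / `partialDeriv_comp_repr`: for `G : ℝ³ → F`, `1`-periodic in the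
  vertical variable and vanishing near the vertical faces of the unit cube (the hypotheses of
  `Torus.isSmooth_comp_repr`, `Literature/Analysis/FunctionSpaces/TorusVerticalLift.lean`), the torus
  derivative of `ξ ↦ G (repr ξ)` at `ξ` is `DG(repr ξ)`, hence `∂ᵢ (G ∘ repr)(ξ) = DG(repr ξ) eᵢ`
  (the lift agrees with `G` near every point of the fundamental cube);
* `KillAll.setIntegral_unitCube_sep`: `∫_{[0,1)³} α(y₀) β(y₁) γ(y₂) = (∫α)(∫β)(∫₀¹γ)` when `α, β`
  vanish off `(0,1)` (`Sep3.integral_sep3`); continuous functions are integrable on the unit cube.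
Nothing is asserted about Navier–Stokes regularity.
-/

noncomputable section

open MeasureTheory Set Function Filter Topology Metric
open scoped ContDiff Real

namespace Summit.NavierStokesRegularity.FunctionalMining

namespace KillAll

open Literature.Analysis.FunctionSpaces Literature.Analysis.FunctionSpaces.Torus

variable {F : Type*} [NormedAddCommGroup F] [NormedSpace ℝ F]

/-! ## The lift of `G ∘ repr` agrees with `G` near the fundamental cube -/

omit [NormedSpace ℝ F] in
/-- Near every point `repr ξ` of the fundamental cube, the lift `y ↦ G (repr (proj y))` of
`ξ ↦ G (repr ξ)` coincides with `G`, provided `G` is `1`-periodic vertically and vanishes near the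
vertical faces of the unit cube. [folklore] -/
theorem eventuallyEq_comp_repr_proj {G : E3 → F}
    (hz : ∀ y : E3, G (y + EuclideanSpace.single 2 1) = G y) {δ : ℝ} (hδ : 0 < δ)
    (h0 : ∀ y : E3, (y 0 ≤ δ ∨ 1 - δ ≤ y 0 ∨ y 1 ≤ δ ∨ 1 - δ ≤ y 1) → G y = 0)
    (ξ : UnitAddTorus (Fin 3)) :
    (fun y : E3 => G (repr (proj y))) =ᶠ[𝓝 (repr ξ)] G := by
  -- the lift with fractional parts, vertical coordinate not reduced
  set P : E3 → E3 := fun y => WithLp.toLp 2 ![Int.fract (y 0), Int.fract (y 1), y 2] with hP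
  have hP0 : ∀ y, P y 0 = Int.fract (y 0) := fun y => by simp [hP]
  have hP1 : ∀ y, P y 1 = Int.fract (y 1) := fun y => by simp [hP]
  have hP2 : ∀ y, P y 2 = y 2 := fun y => by simp [hP]
  have hPeq : ∀ y, G (repr (proj y)) = G (P y) := fun y => by
    have h := periodic_vertical_int hz (⌊y 2⌋) (repr (proj y))
    rw [← h]
    congr 1
    ext i
    fin_cases i <;> simp [repr_proj_apply, hP, Int.fract_add_floor]
  set y₀ : E3 := repr ξ with hy₀
  have hmem : ∀ i, y₀ i ∈ Ico (0 : ℝ) 1 := fun i => repr_apply_mem_Ico ξ i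
  have hcoord : ∀ i : Fin 3, Continuous fun y : E3 => y i := fun i =>
    (continuous_apply i).comp (PiLp.continuous_ofLp 2 _)
  -- if a horizontal coordinate of `y₀` is in `(0,1)`, nearby its fractional part is the identity
  have hgood : ∀ i : Fin 3, 0 < y₀ i → ∀ᶠ y in 𝓝 y₀, Int.fract (y i) = y i := fun i hi => by
    have hIoo : ∀ᶠ y in 𝓝 y₀, y i ∈ Ioo (0 : ℝ) 1 :=
      (hcoord i).continuousAt.eventually (Ioo_mem_nhds hi (hmem i).2)
    exact hIoo.mono fun y hy => Int.fract_eq_self.2 ⟨hy.1.le, hy.2⟩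
  -- if a horizontal coordinate of `y₀` vanishes, nearby both `G (P y)` and `G y` vanish
  have hbad : ∀ i : Fin 3, (i = 0 ∨ i = 1) → y₀ i = 0 →
      ∀ᶠ y in 𝓝 y₀, (Int.fract (y i) ≤ δ ∨ 1 - δ ≤ Int.fract (y i)) ∧ y i ≤ δ := fun i _ hi => by
    have hnear : ∀ᶠ y in 𝓝 y₀, |y i - y₀ i| < δ :=
      ((hcoord i).continuousAt.eventually (Metric.ball_mem_nhds (y₀ i) hδ)).mono fun y hy => by
        simpa [Real.dist_eq] using hy
    filter_upwards [hnear] with y hy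
    rw [hi, sub_zero] at hy
    have hab := abs_lt.1 hy
    refine ⟨?_, hab.2.le⟩
    by_cases hy0 : 0 ≤ y i
    · left
      have hfl : (0 : ℝ) ≤ ⌊y i⌋ := by exact_mod_cast Int.floor_nonneg.2 hy0
      have : Int.fract (y i) = y i - ⌊y i⌋ := rfl
      linarith
    · right
      rw [not_le] at hy0
      have hfl : (⌊y i⌋ : ℝ) ≤ -1 := by
        have h1 : ⌊y i⌋ < (0 : ℤ) := Int.floor_lt.2 (by simpa using hy0)
        have h2 : ⌊y i⌋ ≤ -1 := by omega
        exact_mod_cast h2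
      have : Int.fract (y i) = y i - ⌊y i⌋ := rfl
      linarith
  have key : ∀ᶠ y in 𝓝 y₀, G (P y) = G y := by
    by_cases h0' : 0 < y₀ 0
    · by_cases h1' : 0 < y₀ 1
      · filter_upwards [hgood 0 h0', hgood 1 h1'] with y hy0 hy1
        congr 1
        ext i
        fin_cases i
        · exact (hP0 y).trans hy0
        · exact (hP1 y).trans hy1
        · exact hP2 y
      · have h1z : y₀ 1 = 0 := le_antisymm (not_lt.1 h1') (hmem 1).1
        filter_upwards [hbad 1 (Or.inr rfl) h1z] with y hy
        rw [h0 (P y) (by rw [hP0, hP1]; rcases hy.1 with h | h <;> simp [h]),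
          h0 y (Or.inr (Or.inr (Or.inl hy.2)))]
    · have h0z : y₀ 0 = 0 := le_antisymm (not_lt.1 h0') (hmem 0).1
      filter_upwards [hbad 0 (Or.inl rfl) h0z] with y hy
      rw [h0 (P y) (by rw [hP0, hP1]; rcases hy.1 with h | h <;> simp [h]), h0 y (Or.inl hy.2)]
  exact key.mono fun y hy => (hPeq y).trans hy

/-- **Derivative transfer for the vertical lift.** Under the hypotheses of
`Torus.isSmooth_comp_repr` (vertical `1`-periodicity, vanishing near the vertical faces), the torus
Fréchet derivative of `ξ ↦ G (repr ξ)` at `ξ` is `DG(repr ξ)`. [folklore] -/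
theorem fderiv_comp_repr {G : E3 → F}
    (hz : ∀ y : E3, G (y + EuclideanSpace.single 2 1) = G y) {δ : ℝ} (hδ : 0 < δ)
    (h0 : ∀ y : E3, (y 0 ≤ δ ∨ 1 - δ ≤ y 0 ∨ y 1 ≤ δ ∨ 1 - δ ≤ y 1) → G y = 0)
    (ξ : UnitAddTorus (Fin 3)) :
    Torus.fderiv (fun x : UnitAddTorus (Fin 3) => G (repr x)) ξ = _root_.fderiv ℝ G (repr ξ) := by
  have h := fderiv_lift (fun x : UnitAddTorus (Fin 3) => G (repr x)) (repr ξ)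
  rw [proj_repr] at h
  rw [← h]
  have hl : lift (fun x : UnitAddTorus (Fin 3) => G (repr x)) = fun y => G (repr (proj y)) :=
    funext fun y => lift_apply _ y
  rw [hl]
  exact (eventuallyEq_comp_repr_proj hz hδ h0 ξ).fderiv_eq

/-- **Partial derivatives of `G ∘ repr`**: `∂ᵢ (G ∘ repr)(ξ) = DG(repr ξ) eᵢ` for smooth `G` as above.
[folklore] -/
theorem partialDeriv_comp_repr {G : E3 → F} (hG : ContDiff ℝ ∞ G)
    (hz : ∀ y : E3, G (y + EuclideanSpace.single 2 1) = G y) {δ : ℝ} (hδ : 0 < δ)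
    (h0 : ∀ y : E3, (y 0 ≤ δ ∨ 1 - δ ≤ y 0 ∨ y 1 ≤ δ ∨ 1 - δ ≤ y 1) → G y = 0)
    (i : Fin 3) (ξ : UnitAddTorus (Fin 3)) :
    Torus.partialDeriv i (fun x : UnitAddTorus (Fin 3) => G (repr x)) ξ =
      _root_.fderiv ℝ G (repr ξ) (EuclideanSpace.single i 1) := by
  have hsm : IsContDiff 1 (fun x : UnitAddTorus (Fin 3) => G (repr x)) :=
    (isSmooth_comp_repr hG hz hδ h0).isContDiff (by simp)
  rw [partialDeriv_eq_fderiv_apply hsm, fderiv_comp_repr hz hδ h0]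

/-! ## Fubini on the unit cube for separable integrands -/

/-- `∫_{[0,1)³} α(y₀) β(y₁) γ(y₂) dy = (∫ α)(∫ β)(∫₀¹ γ)` when `α` and `β` vanish off `(0,1)`
(no integrability hypotheses: both sides use the same junk values). [folklore] -/
theorem setIntegral_unitCube_sep (α β γ : ℝ → ℝ) (hα : ∀ t, t ∉ Ioo (0 : ℝ) 1 → α t = 0)
    (hβ : ∀ t, t ∉ Ioo (0 : ℝ) 1 → β t = 0) :
    ∫ y in unitCube (Fin 3), α (y 0) * β (y 1) * γ (y 2) =
      (∫ t, α t) * (∫ t, β t) * ∫ t in (0 : ℝ)..1, γ t := by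
  rw [← integral_indicator measurableSet_unitCube]
  have h : (unitCube (Fin 3)).indicator (fun y : E3 => α (y 0) * β (y 1) * γ (y 2)) =
      fun y : E3 => α (y 0) * β (y 1) * (Ico (0 : ℝ) 1).indicator γ (y 2) := by
    funext y
    by_cases hy : y ∈ unitCube (Fin 3)
    · rw [indicator_of_mem hy, indicator_of_mem ((mem_unitCube.1 hy) 2)]
    · rw [indicator_of_notMem hy]
      rw [mem_unitCube] at hy
      push Not at hy
      obtain ⟨i, hi⟩ := hy
      fin_cases i
      · rw [hα (y 0) fun h => hi (Ioo_subset_Ico_self h)]; ring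
      · rw [hβ (y 1) fun h => hi (Ioo_subset_Ico_self h)]; ring
      · rw [indicator_of_notMem (show y 2 ∉ Ico (0:ℝ) 1 from hi)]; ring
  rw [h, Sep3.integral_sep3, integral_indicator measurableSet_Ico,
    intervalIntegral.integral_of_le zero_le_one, integral_Ico_eq_integral_Ioo,
    ← integral_Ioc_eq_integral_Ioo]

/-- The unit cube lies in the closed ball of radius `2`. [folklore] -/
theorem unitCube_subset_closedBall : unitCube (Fin 3) ⊆ closedBall (0 : E3) 2 := by
  intro y hy
  rw [mem_unitCube] at hy
  rw [mem_closedBall, dist_zero_right, EuclideanSpace.norm_eq]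
  have hs : ∑ i : Fin 3, ‖y i‖ ^ 2 ≤ 4 := by
    have hb : ∀ i : Fin 3, ‖y i‖ ^ 2 ≤ 1 := fun i => by
      have h := hy i
      rw [Real.norm_eq_abs, sq_abs]
      nlinarith [h.1, h.2]
    calc ∑ i : Fin 3, ‖y i‖ ^ 2 ≤ ∑ _i : Fin 3, (1 : ℝ) := Finset.sum_le_sum fun i _ => hb i
      _ = 3 := by simp
      _ ≤ 4 := by norm_num
  calc Real.sqrt (∑ i : Fin 3, ‖y i‖ ^ 2) ≤ Real.sqrt 4 := Real.sqrt_le_sqrt hs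
    _ = 2 := by rw [show (4 : ℝ) = 2 ^ 2 by norm_num, Real.sqrt_sq (by norm_num)]

/-- Continuous functions are integrable on the unit cube. [folklore] -/
theorem integrableOn_unitCube {f : E3 → ℝ} (hf : Continuous f) : IntegrableOn f (unitCube (Fin 3)) :=
  (hf.continuousOn.integrableOn_compact (isCompact_closedBall (0 : E3) 2)).mono_set
    unitCube_subset_closedBall


end KillAll

end Summit.NavierStokesRegularity.FunctionalMining

end
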